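import Mathlib
import Summits.ResolutionOfSingularities.ResolutionOfSingularities.Theorems.RadicialJungCleanModelsCleanProp44TauTwoRegimeLocal
import Summits.ResolutionOfSingularities.ResolutionOfSingularities.Theorems.RadicialJungCleanModelsCleanRegTransport
import Literature.AlgebraicGeometry.Resolution.AlterationsProofs
import Literature.AlgebraicGeometry.Resolution.QuasiExcellentBlowup
import Literature.AlgebraicGeometry.Resolution.BlowupRestrictOpen
import HarnessLib

/-!
# Route `RadicialJung`, crux `CleanModels` (stmt-ResolutionOfSingularities-15917), line `Sketch` rev 35, stub 6 `stub_cleanProp44` (X44c):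
# the clean `τ = 1` isolated-point slice (R2) HOLDS at points WITHOUT VERY NEAR POINTS; X44c ⟸ (R1) ∧ (R2ᵛⁿ) ∧ (R3)

Seat decomp-res-hand-2 g15 (structural hand).  The kernel census of stub 6 is ✓ `cleanProp44_of_tauOneResidual :
hphaseTwo → htauOne → hcurveTauOne → X44c` (hand-2 g11), with (R2) `htauOne` = the clean `τ = 1` ISOLATED-POINT slice relative to an open `V`
(binders of ✓ `CP2008Prop44.stub_tauOne_point` plus the clean data).  Here:

* `exists_isCleanPermissibleSeq_lt_comap_of_isolated_of_forall_near_two_le` — **(R2) HOLDS at an isolated point `x` WITHOUT VERY NEAR POINTS**: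
  the binders of `htauOne` (minus `τ_x = 1` and the G-ring clause, which are not needed) plus «for every blowing up of the open `V` at `x`,
  every closed threefold near point of `x` has `τ ≥ 2`» ⊢ the conclusion of `htauOne` on `V`.  Proof: the open subscheme `V` inherits all
  standing hypotheses (✓ `Scheme.IsRegular.of_isOpenImmersion`, ✓ `Scheme.IsQuasiExcellent.of_locallyOfFiniteType`, ✓
  `CleanRegAt.functionFieldMap_of_isIso_stalkMap`, ✓ `idealOrder_comap_of_isOpenImmersion`, ✓ `CampaignW46.coheight_eq_of_isIso_stalkMap`), its
  `μ`-stratum is `{x}` alone, and ✓ `exists_isCleanPermissibleSeq_lt_of_two_le_stalkTau_off_point` (`…TauTwoRegimeLocal.lean`) applies with `x`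
  as the exceptional point.
* `cleanProp44_of_tauOneResidualVN` — **X44c ⟸ (R1) ∧ (R2ᵛⁿ) ∧ (R3)**, where **(R2ᵛⁿ) is (R2) restricted to isolated `τ = 1` points that HAVE a
  very near point** (the negation of the hypothesis above is added to the binders of `htauOne`); by cases inside (R2).

NET for the planner: the crux-sized hypothesis (R2) of the census shrinks BY NAME to (R2ᵛⁿ): chains of very near `τ = 1` points ([CoP1] p. 11,
T1 ✓ `CP2008Prop44.stub_T1` for coincident centres) and the births of memo 4e §2.4–2.6 are all that (R2) still asks.

Honest framing: OURS; (R1), (R2ᵛⁿ), (R3) are NOT proved here; nothing here proves X44c, any case of `CleanModels`, or resolution of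
singularities in characteristic `p`. [cite: CossartPiltant2008, Prop. 4.2 (b), Lemma 4.3, Lemma 4.5, Prop. 4.4 (proof, p. 11)]
[cite: Piltant2013, Prop. 5.1 (proof, Step 2)]
-/

noncomputable section

set_option linter.dupNamespace false -- mandated namespace of this single-conjunct summit

open CategoryTheory CategoryTheory.Limits AlgebraicGeometry TopologicalSpace IsLocalRing
open Literature.AlgebraicGeometry.Resolution Literature.AlgebraicGeometry.Motives
open Scheme.IdealSheafData
open Summit.ResolutionOfSingularities.ResolutionOfSingularities.Theorems.CP2008Prop44

namespace Summit.ResolutionOfSingularities.ResolutionOfSingularities.Theorems.RadicialJung.CleanModels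

/-! ## §1 (R2) at an isolated point without very near points -/

set_option maxHeartbeats 800000 in
-- transport of the standing hypotheses to the open subscheme
/-- **The clean `τ = 1` isolated-point slice HOLDS at points WITHOUT VERY NEAR POINTS.**  `X` integral Noetherian regular quasi-excellent of
dimension `≤ 3`, `char K(X) = p`, the line of `G` clean-regular at every point; `(J, m)` with `m ≥ 1`, `ord ≤ m`, `V(J)` of codimension `≥ 2`;
`V ⊆ X` open, `x ∈ V` a point of embedding dimension `3` (hence closed) with `ord_x J = m` such that every point of order `≥ m` is `x` or lies
outside `V`; and `x` has NO VERY NEAR POINT: for every blowing up `π₁ : V₁ → V` of the open subscheme `V` at `x`, every closed point `x'` over `x` with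
`ord_{x'} = m` (near) and embedding dimension `3` has `τ_{x'} ≥ 2`.  Then some CLEAN-permissible sequence for `(J|_V, m)` and the line of `G|_V`
brings the order below `m` — the conclusion of (R2) `htauOne` on `V`, with no hypothesis on `τ_x` and no G-ring clause.
[cite: CossartPiltant2008, Prop. 4.2 (b), Lemma 4.3, Prop. 4.4 (proof, p. 11)] -/
theorem exists_isCleanPermissibleSeq_lt_comap_of_isolated_of_forall_near_two_le {p : ℕ} (hp : p.Prime) {X : Scheme.{0}}
    [IsIntegral X] [IsNoetherian X] [hcharX : CharP X.functionField p] (hX : Scheme.IsRegular X) (hqe : Scheme.IsQuasiExcellent X)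
    (hX3 : topologicalKrullDim X ≤ 3) (G : X.functionField)
    (hG : ∀ x : X, CleanRegAt p (algebraMap (X.presheaf.stalk x) X.functionField) G)
    (J : X.IdealSheafData) {m : ℕ} (hm : 1 ≤ m) (hle : ∀ z, idealOrder J z ≤ m) (hcodim : ∀ z ∈ J.support, 1 < Order.coheight z)
    (V : X.Opens) (x : X) (hxV : x ∈ V)
    (hbad : ∀ z : X, (m : ℕ∞) ≤ idealOrder J z → z = x ∨ z ∉ (V : Set X)) (hord : idealOrder J x = m)
    (hdim : (maximalIdeal (X.presheaf.stalk x)).spanFinrank = 3)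
    (hvn : ∀ (hclV : IsClosed ({(⟨x, hxV⟩ : (V : Scheme.{0}))} : Set (V : Scheme.{0})))
      (V₁ : Scheme.{0}) (π₁ : V₁ ⟶ (V : Scheme.{0})), IsBlowup π₁ (vanishingIdeal ⟨{(⟨x, hxV⟩ : (V : Scheme.{0}))}, hclV⟩) →
      ∀ x' : V₁, IsClosed ({x'} : Set V₁) → π₁ x' = ⟨x, hxV⟩ →
        idealOrder (controlledTransform π₁ (vanishingIdeal ⟨{(⟨x, hxV⟩ : (V : Scheme.{0}))}, hclV⟩) (J.comap V.ι) m) x' = m →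
        (maximalIdeal (V₁.presheaf.stalk x')).spanFinrank = 3 →
        ∀ hr : IsRegularLocalRing (V₁.presheaf.stalk x'),
          2 ≤ @stalkTau V₁ (controlledTransform π₁ (vanishingIdeal ⟨{(⟨x, hxV⟩ : (V : Scheme.{0}))}, hclV⟩) (J.comap V.ι) m) x' hr m)
    [IsIntegral ((V : X.Opens) : Scheme.{0})] [IsDominant V.ι] :
    ∃ (V' : Scheme.{0}) (π : V' ⟶ V) (_ : IsIntegral V') (_ : IsDominant π) (K' : V'.IdealSheafData),
      IsCleanPermissibleSeq p π (J.comap V.ι) m K' (RatFn.functionFieldMap V.ι G) ∧ ∀ y, idealOrder K' y < m := by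
  -- the open subscheme `V` inherits the standing hypotheses
  haveI : CompactSpace (V : Scheme.{0}) :=
    ⟨(V.ι.isOpenEmbedding.isInducing.isCompact_iff).mpr (NoetherianSpace.isCompact _)⟩
  haveI : IsNoetherian (V : Scheme.{0}) := {}
  have hV : Scheme.IsRegular (V : Scheme.{0}) := Scheme.IsRegular.of_isOpenImmersion V.ι hX
  have hqeV : Scheme.IsQuasiExcellent (V : Scheme.{0}) := Scheme.IsQuasiExcellent.of_locallyOfFiniteType V.ι hqe
  have hcohV : ∀ v : (V : Scheme.{0}), Order.coheight v = Order.coheight (V.ι v) := fun v =>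
    CampaignW46.coheight_eq_of_isIso_stalkMap V.ι v
  have hcoh3 : ∀ z : X, Order.coheight z ≤ 3 := (topologicalKrullDim_le_iff_forall_coheight_le X 3).mp hX3
  have hV3 : topologicalKrullDim (V : Scheme.{0}) ≤ 3 :=
    (topologicalKrullDim_le_iff_forall_coheight_le _ 3).mpr fun v => (hcohV v).symm ▸ hcoh3 _
  haveI hcharV : CharP (V : Scheme.{0}).functionField p := charP_of_injective_ringHom (RatFn.functionFieldMap V.ι).injective p
  have hGV : ∀ v : (V : Scheme.{0}), CleanRegAt p (algebraMap ((V : Scheme.{0}).presheaf.stalk v) (V : Scheme.{0}).functionField)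
      (RatFn.functionFieldMap V.ι G) := fun v =>
    CleanRegAt.functionFieldMap_of_isIso_stalkMap V.ι v (hG (V.ι v))
  have hordV : ∀ v : (V : Scheme.{0}), idealOrder (J.comap V.ι) v = idealOrder J (V.ι v) := fun v =>
    idealOrder_comap_of_isOpenImmersion V.ι J v
  have hleV : ∀ v : (V : Scheme.{0}), idealOrder (J.comap V.ι) v ≤ m := fun v => by rw [hordV]; exact hle _
  have hcodimV : ∀ v ∈ (J.comap V.ι).support, 1 < Order.coheight v := by
    intro v hv
    rw [← one_le_idealOrder_iff, hordV, one_le_idealOrder_iff] at hv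
    rw [hcohV]
    exact hcodim _ hv
  -- the point `x` seen in `V`
  set x₀ : (V : Scheme.{0}) := ⟨x, hxV⟩ with hx₀def
  have hιx₀ : V.ι x₀ = x := by simp [hx₀def, Scheme.Opens.ι_apply]
  haveI hrx : IsRegularLocalRing (X.presheaf.stalk x) := hX x
  haveI hrx₀ : IsRegularLocalRing ((V : Scheme.{0}).presheaf.stalk x₀) := hV x₀
  have hcohx : Order.coheight x = 3 := by
    have h := CampaignW46.coheight_eq_spanFinrank x
    rw [hdim] at h
    exact_mod_cast h
  have hcohx₀ : Order.coheight x₀ = 3 := by rw [hcohV, hιx₀, hcohx]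
  have hcoh3V : ∀ v : (V : Scheme.{0}), Order.coheight v ≤ 3 := (topologicalKrullDim_le_iff_forall_coheight_le _ 3).mp hV3
  have hclV : IsClosed ({x₀} : Set (V : Scheme.{0})) := isClosed_singleton_of_coheight_eq_three hcoh3V hcohx₀
  have hordx₀ : idealOrder (J.comap V.ι) x₀ = m := by rw [hordV, hιx₀, hord]
  -- in `V` the `m`-stratum is `{x₀}`: `τ ≥ 2` off `x₀` holds vacuously
  have hτ2V : ∀ v : (V : Scheme.{0}), v ≠ x₀ → IsClosed ({v} : Set (V : Scheme.{0})) → idealOrder (J.comap V.ι) v = m →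
      (maximalIdeal ((V : Scheme.{0}).presheaf.stalk v)).spanFinrank = 3 →
      ∀ hr : IsRegularLocalRing ((V : Scheme.{0}).presheaf.stalk v), 2 ≤ @stalkTau (V : Scheme.{0}) (J.comap V.ι) v hr m := by
    intro v hv _ hordv _ _
    exfalso
    have hmem : V.ι v ∈ (V : Set X) := by rw [← Scheme.Opens.range_ι V]; exact ⟨v, rfl⟩
    rcases hbad (V.ι v) (by rw [← hordV, hordv]) with h | h
    · apply hv
      apply V.ι.isOpenEmbedding.injective
      rw [h, hιx₀]
    · exact h hmem
  -- the stage-free «one exceptional point» theorem on `V`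
  exact exists_isCleanPermissibleSeq_lt_of_two_le_stalkTau_off_point hp hV hqeV hV3 (RatFn.functionFieldMap V.ι G) hGV (J.comap V.ι) hm
    hleV hcodimV x₀ hclV hordx₀ (hvn hclV) hτ2V

/-! ## §2 X44c ⟸ (R1) ∧ (R2ᵛⁿ) ∧ (R3) -/

set_option maxHeartbeats 1600000 in
-- long binder lists
/-- **THE CLEAN ASSEMBLY, FOURTH CUT: X44c (`stub_cleanProp44`, verbatim) from clean Phase II of reach-tidy (R1), the clean `τ = 1` isolated-point slice
AT POINTS WITH A VERY NEAR POINT (R2ᵛⁿ), and the clean curve slice through a `τ = 1` point (R3).**  (R2ᵛⁿ) = the hypothesis `htauOne` of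
✓ `cleanProp44_of_tauOneResidual` with ONE MORE binder: `x` has a very near point (the negation of the hypothesis `hvn` of
`exists_isCleanPermissibleSeq_lt_comap_of_isolated_of_forall_near_two_le`).  Proof: cases inside (R2). [cite: CossartPiltant2008, Prop. 4.4, Lemma 4.5]
[cite: Piltant2013, Prop. 5.1 (proof, Step 2)] -/
theorem cleanProp44_of_tauOneResidualVN
    (hphaseTwo : ∀ (p : ℕ), p.Prime → ∀ {X : Scheme.{0}} [IsIntegral X] [IsNoetherian X], CharP X.functionField p →
      ∀ (hX : Scheme.IsRegular X), Scheme.IsQuasiExcellent X → topologicalKrullDim X ≤ 3 →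
      ∀ (G : X.functionField), (∀ x : X, CleanRegAt p (algebraMap (X.presheaf.stalk x) X.functionField) G) →
      ∀ (J : X.IdealSheafData) {μ : ℕ}, 1 ≤ μ → (∀ z, idealOrder J z ≤ μ) → (∀ z ∈ J.support, 1 < Order.coheight z) →
      (∀ x : X, ¬ ∃ C ∈ {C : Closeds X | ∃ ζ ∈ maxPoints {z : X | (μ : ℕ∞) ≤ idealOrder J z},
          ¬ IsClosed ({ζ} : Set X) ∧ C = ⟨closure {ζ}, isClosed_closure⟩},
        x ∈ (vanishingIdeal C).subschemeι '' (Scheme.regularLocus (vanishingIdeal C).subscheme)ᶜ ∨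
        (x ∈ (C : Set X) ∧ ∃ C' ∈ {C : Closeds X | ∃ ζ ∈ maxPoints {z : X | (μ : ℕ∞) ≤ idealOrder J z},
            ¬ IsClosed ({ζ} : Set X) ∧ C = ⟨closure {ζ}, isClosed_closure⟩}, C' ≠ C ∧ x ∈ (C' : Set X) ∧
          stalkIdeal (vanishingIdeal C) x ⊔ stalkIdeal (vanishingIdeal C') x ≠ maximalIdeal (X.presheaf.stalk x))) →
      ∃ (X₁ : Scheme.{0}) (Φ : X₁ ⟶ X) (_ : IsIntegral X₁) (_ : IsDominant Φ) (J₁ : X₁.IdealSheafData)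
        (_ : IsCleanPermissibleSeq p Φ J μ J₁ G),
        (∀ ζ : X₁, (μ : ℕ∞) ≤ idealOrder J₁ ζ → Order.coheight ζ = 2 → ¬ IsClosed ({ζ} : Set X₁) →
            Scheme.IsRegular (vanishingIdeal (⟨closure {ζ}, isClosed_closure⟩ : Closeds X₁)).subscheme) ∧
        (∀ ζ₁ ζ₂ : X₁, (μ : ℕ∞) ≤ idealOrder J₁ ζ₁ → Order.coheight ζ₁ = 2 → ¬ IsClosed ({ζ₁} : Set X₁) →
            (μ : ℕ∞) ≤ idealOrder J₁ ζ₂ → Order.coheight ζ₂ = 2 → ¬ IsClosed ({ζ₂} : Set X₁) → ζ₁ ≠ ζ₂ →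
            Disjoint (closure ({ζ₁} : Set X₁)) (closure {ζ₂})))
    (htauOneVN : ∀ (p : ℕ), p.Prime → ∀ {X : Scheme.{0}} [IsIntegral X] [IsNoetherian X], CharP X.functionField p →
      ∀ (hX : Scheme.IsRegular X), Scheme.IsQuasiExcellent X → topologicalKrullDim X ≤ 3 →
      ∀ (G : X.functionField), (∀ x : X, CleanRegAt p (algebraMap (X.presheaf.stalk x) X.functionField) G) →
      ∀ (J : X.IdealSheafData) {m : ℕ}, 1 ≤ m → (∀ z, idealOrder J z ≤ m) → (∀ z ∈ J.support, 1 < Order.coheight z) →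
      ∀ (V : X.Opens) (x : X) (hxV : x ∈ V), ∀ (hcl : IsClosed ({x} : Set X)),
      (∀ z : X, (m : ℕ∞) ≤ idealOrder J z → z = x ∨ z ∉ (V : Set X)) → idealOrder J x = m →
      (maximalIdeal (X.presheaf.stalk x)).spanFinrank = 3 → (haveI := hX x; stalkTau J x m = 1) → IsGRing (X.presheaf.stalk x) →
      -- (VN) `x` HAS a very near point: some closed threefold near point of `x` (for some blowing up of `V` at `x`) has `τ ≤ 1`
      (¬ ∀ (hclV : IsClosed ({(⟨x, hxV⟩ : (V : Scheme.{0}))} : Set (V : Scheme.{0})))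
        (V₁ : Scheme.{0}) (π₁ : V₁ ⟶ (V : Scheme.{0})), IsBlowup π₁ (vanishingIdeal ⟨{(⟨x, hxV⟩ : (V : Scheme.{0}))}, hclV⟩) →
        ∀ x' : V₁, IsClosed ({x'} : Set V₁) → π₁ x' = ⟨x, hxV⟩ →
          idealOrder (controlledTransform π₁ (vanishingIdeal ⟨{(⟨x, hxV⟩ : (V : Scheme.{0}))}, hclV⟩) (J.comap V.ι) m) x' = m →
          (maximalIdeal (V₁.presheaf.stalk x')).spanFinrank = 3 →
          ∀ hr : IsRegularLocalRing (V₁.presheaf.stalk x'),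
            2 ≤ @stalkTau V₁ (controlledTransform π₁ (vanishingIdeal ⟨{(⟨x, hxV⟩ : (V : Scheme.{0}))}, hclV⟩) (J.comap V.ι) m) x' hr m) →
      ∀ [IsIntegral ((V : X.Opens) : Scheme.{0})] [IsDominant V.ι],
      ∃ (V' : Scheme.{0}) (π : V' ⟶ V) (_ : IsIntegral V') (_ : IsDominant π) (K' : V'.IdealSheafData),
        IsCleanPermissibleSeq p π (J.comap V.ι) m K' (RatFn.functionFieldMap V.ι G) ∧ ∀ y, idealOrder K' y < m)
    (hcurveTauOne : ∀ (p : ℕ), p.Prime → ∀ {X : Scheme.{0}} [IsIntegral X] [IsNoetherian X], CharP X.functionField p →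
      ∀ (hX : Scheme.IsRegular X), Scheme.IsQuasiExcellent X → topologicalKrullDim X ≤ 3 →
      ∀ (G : X.functionField), (∀ x : X, CleanRegAt p (algebraMap (X.presheaf.stalk x) X.functionField) G) →
      ∀ (J : X.IdealSheafData) {m : ℕ}, 1 ≤ m → (∀ z, idealOrder J z ≤ m) → (∀ z ∈ J.support, 1 < Order.coheight z) →
      ∀ (V : X.Opens) (Y : Closeds X), Scheme.IsRegular (vanishingIdeal Y).subscheme → IsIrreducible (Y : Set X) →
      (Y : Set X) ⊆ (V : Set X) → (∀ z : X, (m : ℕ∞) ≤ idealOrder J z → z ∈ (Y : Set X) ∨ z ∉ (V : Set X)) →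
      (∀ y ∈ (Y : Set X), idealOrder J y = m) →
      (∀ y ∈ (Y : Set X), haveI := hX y; ∃ c : Fin 2 → X.presheaf.stalk y, IsRsopPart c ∧
        Ideal.span (Set.range c) = stalkIdeal (vanishingIdeal Y) y) →
      (¬ ∀ y ∈ (Y : Set X), IsClosed ({y} : Set X) → haveI := hX y; 2 ≤ stalkTau J y m) →
      ∀ [IsIntegral ((V : X.Opens) : Scheme.{0})] [IsDominant V.ι],
      ∃ (V' : Scheme.{0}) (π : V' ⟶ V) (_ : IsIntegral V') (_ : IsDominant π) (K' : V'.IdealSheafData),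
        IsCleanPermissibleSeq p π (J.comap V.ι) m K' (RatFn.functionFieldMap V.ι G) ∧ ∀ y, idealOrder K' y < m) :
    ∀ (p : ℕ), p.Prime → ∀ (S : Scheme.{0}) [IsIntegral S] [IsNoetherian S],
      CharP S.functionField p → Scheme.IsRegular S → Scheme.IsExcellent S → topologicalKrullDim S = 3 →
      ∀ G₀ : S.functionField, (∀ s : S, CleanRegAt p (algebraMap (S.presheaf.stalk s) S.functionField) G₀) →
      ∀ I : S.IdealSheafData, I ≠ ⊥ →
      ∀ (X : Scheme.{0}) (ρ : X ⟶ S) [IsIntegral X] [IsNoetherian X] [IsDominant ρ],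
        IsCleanRegularCentreBlowupSeq p ρ I G₀ →
        (∀ x : X, CleanRegAt p (algebraMap (X.presheaf.stalk x) X.functionField) (RatFn.functionFieldMap ρ G₀)) →
        ∀ (J : X.IdealSheafData) (μ : ℕ), 1 ≤ μ →
          (∀ x ∈ J.support, 1 < Order.coheight x) → (∀ x, idealOrder J x ≤ μ) → (∃ x, idealOrder J x = μ) →
          ∃ (X' : Scheme.{0}) (π : X' ⟶ X) (_ : IsIntegral X') (_ : IsDominant π) (J' : X'.IdealSheafData),
            IsCleanPermissibleSeq p π J μ J' (RatFn.functionFieldMap ρ G₀) ∧ ∀ x, idealOrder J' x < μ := by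
  refine cleanProp44_of_tauOneResidual hphaseTwo ?_ hcurveTauOne
  intro p hp X _ _ hchar hX hqe hX3 G hG J m hm hle hcodim V x hxV hcl hbad hord hdim hτ hGr _ _
  by_cases hvn : ∀ (hclV : IsClosed ({(⟨x, hxV⟩ : (V : Scheme.{0}))} : Set (V : Scheme.{0})))
      (V₁ : Scheme.{0}) (π₁ : V₁ ⟶ (V : Scheme.{0})), IsBlowup π₁ (vanishingIdeal ⟨{(⟨x, hxV⟩ : (V : Scheme.{0}))}, hclV⟩) →
      ∀ x' : V₁, IsClosed ({x'} : Set V₁) → π₁ x' = ⟨x, hxV⟩ →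
        idealOrder (controlledTransform π₁ (vanishingIdeal ⟨{(⟨x, hxV⟩ : (V : Scheme.{0}))}, hclV⟩) (J.comap V.ι) m) x' = m →
        (maximalIdeal (V₁.presheaf.stalk x')).spanFinrank = 3 →
        ∀ hr : IsRegularLocalRing (V₁.presheaf.stalk x'),
          2 ≤ @stalkTau V₁ (controlledTransform π₁ (vanishingIdeal ⟨{(⟨x, hxV⟩ : (V : Scheme.{0}))}, hclV⟩) (J.comap V.ι) m) x' hr m
  · haveI := hchar
    exact exists_isCleanPermissibleSeq_lt_comap_of_isolated_of_forall_near_two_le hp hX hqe hX3 G hG J hm hle hcodim V x hxV hbad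
      hord hdim hvn
  · exact htauOneVN p hp hchar hX hqe hX3 G hG J hm hle hcodim V x hxV hcl hbad hord hdim hτ hGr hvn

end Summit.ResolutionOfSingularities.ResolutionOfSingularities.Theorems.RadicialJung.CleanModels

end
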